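import Summits.CriticalPhenomena.PercolationContinuityZ3.Theorems.PercNearOneGluingNoHeavyLowerTailQ7PsiMonotone
import Literature.Probability.Percolation.TwoClusterGibbsSampler
import HarnessLib

/-!
# `NoHeavyLowerTail` (stmt-CriticalPhenomena-4575) — the observer/strong-relay covariance comparison
# (the `z`-free core of the dual certificate for (GΨ₃))

Support file (`--supports stmt-CriticalPhenomena-4575`), coupling seat `prim-cplus-coupling` (gen 7).  No
definitions, no named facts, no sorries.

Context (seat memo A5-COUPLING-gen7.md §0).  The census certificate for the conjecture (GΨ₃) (general
monotone cluster properties, three relays; A5-COUPLING-gen5.md §3–§4, ttrl q7psi RESULT 3) is the dual point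
`t* = φE1/(φE1+φE2)` on the mass-balance line.  It splits into an `x`-half and a `y`-half, and each half
reduces (two-set BHK) to the covariance comparison
`Cov_ν(𝟙_U, 𝟙{o ∈ C(x)}) ≥ P(o ↔ y | y ↮ {x,z}) · Cov_ν(𝟙_U, 𝟙{y ∈ C(x)})`, `ν = P(· | x ↮ z)`,
for every increasing function of the cluster of `x`.  This file PROVES the `z`-free case of that
comparison (no conditioning on `z`), for every finite weighted graph and every monotone real cluster
property `F`:

* `Q7Psi.obs_mixture_ge` — with `D = {x ↮ y}` and `J = {x ↔ o} ∪ {y ↔ o}`,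
  `μ(D) · μ(J) · E F(C(x)) ≤ μ(D) · E[F(C(x)); x ↔ o] + μ(D ∩ {y ↔ o}) · E[F(C(x)); D]`;
* `Q7Psi.obs_cov_ge` — the covariance form
  `μ(D) · (E[F(C(x)); x ↔ o] − μ(x ↔ o) E F(C(x))) ≥ μ(D ∩ {y ↔ o}) · (E[F(C(x)); x ↔ y] − μ(x ↔ y) E F(C(x)))`,
  i.e. `Cov(F(C_x), 𝟙{o ↔ x}) ≥ P(o ↔ y | x ↮ y) · Cov(F(C_x), 𝟙{x ↔ y})` — a Kozma–Nitzan-Lemma-2-type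
  superadditivity (`P(o ∈ C | x ↔ y) ≥ P(o ↔ x | x ↮ y) + P(o ↔ y | x ↮ y)` is its value at `F = 𝟙{y ∈ ·}`)
  for an arbitrary monotone cluster property in place of `𝟙{y ∈ C(x)}`;
* `Q7Psi.obs_exchange` — `μ(D ∩ {y ↔ o}) · E[F(C(x)); D ∩ {x ↔ o}] ≥ μ(D ∩ {x ↔ o}) · E[F(C(x)); D ∩ {y ↔ o}]`
  ("given `x ↮ y`, the cluster of `x` is larger when the observer hangs on `x` than when it hangs on `y`").

Proof (three lines on paper): BHK Thm 1.4 given `{x ↮ y}` (`F(C_x)` increasing in `C_x`, `𝟙{y ↔ o}`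
increasing in `C_y`) gives `μ(D) E[F(C_x); D, y↔o] ≤ E[F(C_x); D] μ(D ∩ {y↔o})`; Harris gives
`μ(J) E F(C_x) ≤ E[F(C_x); J]`; and `J = {x↔o} ⊔ (D ∩ {y↔o})`.  `obs_exchange` is BHK Thm 1.3 + Thm 1.4.
[cite: VandenbergHaggstromKahn2005, Thms 1.3, 1.4 (pp. 6–7); §1 p. 6 (Harris)]
[cite: KozmaNitzan2024, Lemma 2 (p. 6), §5.1 (pp. 31–32), Question 7 (p. 36)]
-/

namespace Summit.CriticalPhenomena.PercolationContinuityZ3.Theorems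

open MeasureTheory Set Literature.Probability.LatticeModels Literature.Probability.Percolation
open scoped Classical
open KNPreFKG

noncomputable section

namespace Q7Psi

variable {V : Type*} [Fintype V]

/-- **BHK Thm 1.4 for a real cluster property and an observer**: with `D = {x ↮ y}`,
`μ(D) · ∫_{D ∩ {y ↔ o}} F(C(x)) ≤ (∫_D F(C(x))) · μ(D ∩ {y ↔ o})` — given `x ↮ y`, the increasing
function `F(C_x)` of the cluster of `x` and the increasing event `{y ↔ o}` of the cluster of `y` are
negatively correlated. [cite: VandenbergHaggstromKahn2005, Thm. 1.4 (p. 7)] -/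
theorem obs_neg (w : Sym2 V → unitInterval) (o x y : V) (hxy : x ≠ y) (F : Set V → ℝ)
    (hF : ∀ S T : Set V, S ⊆ T → F S ≤ F T) :
    (prodBernoulli w).real {ω : BondConfig V | ¬ (openGraph ω).Reachable x y} *
        ∫ ω in {ω : BondConfig V | ¬ (openGraph ω).Reachable x y} ∩ openConn y o,
          F (openCluster ω x) ∂(prodBernoulli w) ≤
      (∫ ω in {ω : BondConfig V | ¬ (openGraph ω).Reachable x y}, F (openCluster ω x) ∂(prodBernoulli w)) *
        (prodBernoulli w).real ({ω : BondConfig V | ¬ (openGraph ω).Reachable x y} ∩ openConn y o) := by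
  classical
  have key := (BHK2006_twoClusterConditionalAssociation_holds).negCorrelation V w x y
    (fun C => F {a | a = x ∨ ∃ e ∈ C, a ∈ e}) (connIndicatorFn y o)
    (monotone_clusterFun x F hF) (monotone_connIndicatorFn y o) hxy
  simp only [clusterFun_openEdgeCluster, connIndicatorFn_openEdgeCluster] at key
  rw [setIntegral_mul_indicator_one, setIntegral_indicator_one_eq] at key
  exact key

/-- **BHK Thm 1.3 for a real cluster property and an observer**: with `D = {x ↮ y}`,
`(∫_D F(C(x))) · μ(D ∩ {x ↔ o}) ≤ μ(D) · ∫_{D ∩ {x ↔ o}} F(C(x))` — given `x ↮ y`, the cluster of `x`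
is positively associated. [cite: VandenbergHaggstromKahn2005, Thm. 1.3 (p. 6)] -/
theorem obs_pos (w : Sym2 V → unitInterval) (o x y : V) (hxy : x ≠ y) (F : Set V → ℝ)
    (hF : ∀ S T : Set V, S ⊆ T → F S ≤ F T) :
    (∫ ω in {ω : BondConfig V | ¬ (openGraph ω).Reachable x y}, F (openCluster ω x) ∂(prodBernoulli w)) *
        (prodBernoulli w).real ({ω : BondConfig V | ¬ (openGraph ω).Reachable x y} ∩ openConn x o) ≤
      (prodBernoulli w).real {ω : BondConfig V | ¬ (openGraph ω).Reachable x y} *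
        ∫ ω in {ω : BondConfig V | ¬ (openGraph ω).Reachable x y} ∩ openConn x o,
          F (openCluster ω x) ∂(prodBernoulli w) := by
  classical
  have hD : {ω : BondConfig V | ∀ t ∈ ({y} : Set V), ¬ (openGraph ω).Reachable x t} =
      {ω : BondConfig V | ¬ (openGraph ω).Reachable x y} := by
    ext ω
    simp only [mem_singleton_iff, forall_eq, mem_setOf_eq]
  have key := BHK2006_clusterConditionalPositiveAssociation_holds V w x ({y} : Set V)
    (fun C => F {a | a = x ∨ ∃ e ∈ C, a ∈ e}) (connIndicatorFn x o) (monotone_clusterFun x F hF)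
    (monotone_connIndicatorFn x o) (by simpa using hxy)
  simp only [hD, clusterFun_openEdgeCluster, connIndicatorFn_openEdgeCluster] at key
  rw [setIntegral_mul_indicator_one, setIntegral_indicator_one_eq] at key
  exact key

/-- **The observer exchange** (`z`-free form of the seat's lemma (R)): with `D = {x ↮ y}`,
`μ(D ∩ {x ↔ o}) · ∫_{D ∩ {y ↔ o}} F(C(x)) ≤ μ(D ∩ {y ↔ o}) · ∫_{D ∩ {x ↔ o}} F(C(x))` — given `x ↮ y`, the
law of the cluster of `x` when the observer is attached to `y` lies below its law when the observer is
attached to `x` (BHK Thm 1.3 and Thm 1.4 chained through `∫_D F(C(x))`).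
[cite: VandenbergHaggstromKahn2005, Thms 1.3, 1.4 (pp. 6–7)] -/
theorem obs_exchange (w : Sym2 V → unitInterval) (o x y : V) (hxy : x ≠ y) (F : Set V → ℝ)
    (hF : ∀ S T : Set V, S ⊆ T → F S ≤ F T) :
    (prodBernoulli w).real ({ω : BondConfig V | ¬ (openGraph ω).Reachable x y} ∩ openConn x o) *
        ∫ ω in {ω : BondConfig V | ¬ (openGraph ω).Reachable x y} ∩ openConn y o,
          F (openCluster ω x) ∂(prodBernoulli w) ≤
      (prodBernoulli w).real ({ω : BondConfig V | ¬ (openGraph ω).Reachable x y} ∩ openConn y o) *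
        ∫ ω in {ω : BondConfig V | ¬ (openGraph ω).Reachable x y} ∩ openConn x o,
          F (openCluster ω x) ∂(prodBernoulli w) := by
  classical
  set μ := prodBernoulli w with hμ
  set D : Set (BondConfig V) := {ω | ¬ (openGraph ω).Reachable x y} with hD
  set f : BondConfig V → ℝ := fun ω => F (openCluster ω x) with hf
  have h13 := obs_pos w o x y hxy F hF
  have h14 := obs_neg w o x y hxy F hF
  -- names
  change (∫ ω in D, f ω ∂μ) * μ.real (D ∩ openConn x o) ≤ μ.real D * ∫ ω in D ∩ openConn x o, f ω ∂μ
    at h13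
  change μ.real D * ∫ ω in D ∩ openConn y o, f ω ∂μ ≤ (∫ ω in D, f ω ∂μ) * μ.real (D ∩ openConn y o)
    at h14
  show μ.real (D ∩ openConn x o) * ∫ ω in D ∩ openConn y o, f ω ∂μ ≤
    μ.real (D ∩ openConn y o) * ∫ ω in D ∩ openConn x o, f ω ∂μ
  have hmx : 0 ≤ μ.real (D ∩ openConn x o) := measureReal_nonneg
  have hmy : 0 ≤ μ.real (D ∩ openConn y o) := measureReal_nonneg
  by_cases hD0 : μ.real D = 0
  · have hx0 : μ.real (D ∩ openConn x o) = 0 :=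
      le_antisymm ((measureReal_mono inter_subset_left).trans hD0.le) measureReal_nonneg
    have hy0 : μ.real (D ∩ openConn y o) = 0 :=
      le_antisymm ((measureReal_mono inter_subset_left).trans hD0.le) measureReal_nonneg
    rw [hx0, hy0, zero_mul, zero_mul]
  · have hDpos : 0 < μ.real D := lt_of_le_of_ne measureReal_nonneg (Ne.symm hD0)
    -- μD · (μ(D∩Ox) ∫_{D∩Oy} f) ≤ μ(D∩Ox) (∫_D f) μ(D∩Oy) ≤ μD · μ(D∩Oy) ∫_{D∩Ox} f
    have h1 : μ.real D * (μ.real (D ∩ openConn x o) * ∫ ω in D ∩ openConn y o, f ω ∂μ) ≤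
        μ.real (D ∩ openConn x o) * ((∫ ω in D, f ω ∂μ) * μ.real (D ∩ openConn y o)) := by
      have := mul_le_mul_of_nonneg_left h14 hmx
      linarith
    have h2 : μ.real (D ∩ openConn x o) * ((∫ ω in D, f ω ∂μ) * μ.real (D ∩ openConn y o)) ≤
        μ.real D * (μ.real (D ∩ openConn y o) * ∫ ω in D ∩ openConn x o, f ω ∂μ) := by
      have := mul_le_mul_of_nonneg_right h13 hmy
      linarith
    exact le_of_mul_le_mul_left (h1.trans h2) hDpos

/-- **Harris for a real cluster property and the observer's union event**: with
`J = {x ↔ o} ∪ {y ↔ o}`, `μ(J) · ∫ F(C(x)) ≤ ∫_J F(C(x))` — both `F(C_x(ω))` and `𝟙_J` are increasing in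
the configuration. [cite: VandenbergHaggstromKahn2005, §1 p. 6 (Harris' inequality)] -/
theorem harris_obs_union (w : Sym2 V → unitInterval) (o x y : V) (F : Set V → ℝ)
    (hF : ∀ S T : Set V, S ⊆ T → F S ≤ F T) :
    (prodBernoulli w).real (openConn x o ∪ openConn y o) * ∫ ω, F (openCluster ω x) ∂(prodBernoulli w) ≤
      ∫ ω in openConn x o ∪ openConn y o, F (openCluster ω x) ∂(prodBernoulli w) := by
  classical
  set μ := prodBernoulli w with hμ
  set J : Set (BondConfig V) := openConn x o ∪ openConn y o with hJ
  have hJm : MeasurableSet J := MeasurableSet.of_discrete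
  have hfm : Monotone fun ω : BondConfig V => F (openCluster ω x) :=
    fun ω ω' h => hF _ _ (openCluster_mono h x)
  have hJup : IsUpperSet J := by
    intro ω ω' hle hω
    rcases hω with h | h
    · exact Or.inl (h.mono (SimpleGraph.fromEdgeSet_mono hle))
    · exact Or.inr (h.mono (SimpleGraph.fromEdgeSet_mono hle))
  have hgm : Monotone (J.indicator (1 : BondConfig V → ℝ)) := monotone_indicator_one_of_isUpperSet hJup
  have key := BHK2006.integral_mul_le_prodBernoulli w hfm hgm
  have h1 : ∫ ω, J.indicator (1 : BondConfig V → ℝ) ω ∂μ = μ.real J := by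
    rw [integral_indicator_one hJm]
  have h2 : ∫ ω, F (openCluster ω x) * J.indicator (1 : BondConfig V → ℝ) ω ∂μ =
      ∫ ω in J, F (openCluster ω x) ∂μ := by
    have hfun : (fun ω => F (openCluster ω x) * J.indicator (1 : BondConfig V → ℝ) ω) =
        J.indicator (fun ω => F (openCluster ω x)) := by
      funext ω
      by_cases h : ω ∈ J
      · rw [indicator_of_mem h, indicator_of_mem h, Pi.one_apply, mul_one]
      · rw [indicator_of_notMem h, indicator_of_notMem h, mul_zero]
    rw [hfun, integral_indicator hJm]
  rw [h1, h2] at key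
  linarith [key]

/-- **The `z`-free observer mixture inequality (Q-F).**  With `D = {x ↮ y}` and `J = {x ↔ o} ∪ {y ↔ o}`,
`μ(D) · μ(J) · ∫ F(C(x)) ≤ μ(D) · ∫_{x ↔ o} F(C(x)) + μ(D ∩ {y ↔ o}) · ∫_D F(C(x))`
for every monotone real cluster property `F`: the mixture
`[μ(x↔o) · L(C_x | x↔o) + μ(y↔o, x↮y) · L(C_x | x↔o, x↮y)] / μ(J)` dominates `L(C_x)`.
Proof: BHK Thm 1.4 (`obs_neg`), Harris (`harris_obs_union`), and `J = {x↔o} ⊔ (D ∩ {y↔o})`.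
[cite: VandenbergHaggstromKahn2005, Thms 1.3–1.4 (pp. 6–7)] [cite: KozmaNitzan2024, Lemma 2 (p. 6), §5.1 (p. 31)] -/
theorem obs_mixture_ge (w : Sym2 V → unitInterval) (o x y : V) (hxy : x ≠ y) (F : Set V → ℝ)
    (hF : ∀ S T : Set V, S ⊆ T → F S ≤ F T) :
    (prodBernoulli w).real {ω : BondConfig V | ¬ (openGraph ω).Reachable x y} *
        (prodBernoulli w).real (openConn x o ∪ openConn y o) * ∫ ω, F (openCluster ω x) ∂(prodBernoulli w) ≤
      (prodBernoulli w).real {ω : BondConfig V | ¬ (openGraph ω).Reachable x y} *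
          ∫ ω in openConn x o, F (openCluster ω x) ∂(prodBernoulli w) +
        (prodBernoulli w).real ({ω : BondConfig V | ¬ (openGraph ω).Reachable x y} ∩ openConn y o) *
          ∫ ω in {ω : BondConfig V | ¬ (openGraph ω).Reachable x y}, F (openCluster ω x) ∂(prodBernoulli w) := by
  classical
  set μ := prodBernoulli w with hμ
  set D : Set (BondConfig V) := {ω | ¬ (openGraph ω).Reachable x y} with hD
  set f : BondConfig V → ℝ := fun ω => F (openCluster ω x) with hf
  set J : Set (BondConfig V) := openConn x o ∪ openConn y o with hJ
  have h14 := obs_neg w o x y hxy F hF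
  change μ.real D * ∫ ω in D ∩ openConn y o, f ω ∂μ ≤ (∫ ω in D, f ω ∂μ) * μ.real (D ∩ openConn y o)
    at h14
  have hH := harris_obs_union w o x y F hF
  change μ.real J * ∫ ω, f ω ∂μ ≤ ∫ ω in J, f ω ∂μ at hH
  show μ.real D * μ.real J * ∫ ω, f ω ∂μ ≤
    μ.real D * ∫ ω in openConn x o, f ω ∂μ + μ.real (D ∩ openConn y o) * ∫ ω in D, f ω ∂μ
  -- `J = {x ↔ o} ⊔ (D ∩ {y ↔ o})`
  have hJeq : J = openConn x o ∪ (D ∩ openConn y o) := by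
    ext ω
    simp only [hJ, hD, mem_union, mem_inter_iff, mem_setOf_eq, openConn]
    constructor
    · rintro (h | h)
      · exact Or.inl h
      · by_cases hxo : (openGraph ω).Reachable x o
        · exact Or.inl hxo
        · refine Or.inr ⟨fun hxy' => hxo (hxy'.trans h), h⟩
    · rintro (h | ⟨_, h⟩)
      · exact Or.inl h
      · exact Or.inr h
  have hdisj : Disjoint (openConn x o) (D ∩ openConn y o) := by
    rw [Set.disjoint_left]
    rintro ω hxo ⟨hD', hyo⟩
    exact hD' (SimpleGraph.Reachable.trans hxo (SimpleGraph.Reachable.symm hyo))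
  have hsplit : ∫ ω in J, f ω ∂μ = ∫ ω in openConn x o, f ω ∂μ + ∫ ω in D ∩ openConn y o, f ω ∂μ := by
    rw [hJeq]
    exact setIntegral_union hdisj MeasurableSet.of_discrete (Integrable.of_finite).integrableOn
      (Integrable.of_finite).integrableOn
  have hDnn : 0 ≤ μ.real D := measureReal_nonneg
  have h1 : μ.real D * μ.real J * ∫ ω, f ω ∂μ ≤ μ.real D * ∫ ω in J, f ω ∂μ := by
    have := mul_le_mul_of_nonneg_left hH hDnn
    linarith
  rw [hsplit, mul_add] at h1
  linarith

/-- **The `z`-free observer covariance comparison (Q**).**  With `D = {x ↮ y}`,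
`μ(D) · (∫_{x↔o} F(C(x)) − μ(x↔o) ∫ F(C(x))) ≥ μ(D ∩ {y↔o}) · (∫_{x↔y} F(C(x)) − μ(x↔y) ∫ F(C(x)))`,
i.e. `Cov(F(C_x), 𝟙{x↔o}) ≥ P(y↔o | x↮y) · Cov(F(C_x), 𝟙{x↔y})` for every monotone real cluster
property `F` (algebraic rearrangement of `obs_mixture_ge`, `μ` being a probability measure).  At
`F = 𝟙{y ∈ ·}` it is Kozma–Nitzan's Lemma-2 bound `P(o ∈ C(x) | x↔y) ≥ P(o↔x | x↮y) + P(o↔y | x↮y)`.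
[cite: KozmaNitzan2024, Lemma 2 (p. 6)] [cite: VandenbergHaggstromKahn2005, Thms 1.3–1.4 (pp. 6–7)] -/
theorem obs_cov_ge (w : Sym2 V → unitInterval) (o x y : V) (hxy : x ≠ y) (F : Set V → ℝ)
    (hF : ∀ S T : Set V, S ⊆ T → F S ≤ F T) :
    (prodBernoulli w).real ({ω : BondConfig V | ¬ (openGraph ω).Reachable x y} ∩ openConn y o) *
        (∫ ω in openConn x y, F (openCluster ω x) ∂(prodBernoulli w) -
          (prodBernoulli w).real (openConn x y) * ∫ ω, F (openCluster ω x) ∂(prodBernoulli w)) ≤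
      (prodBernoulli w).real {ω : BondConfig V | ¬ (openGraph ω).Reachable x y} *
        (∫ ω in openConn x o, F (openCluster ω x) ∂(prodBernoulli w) -
          (prodBernoulli w).real (openConn x o) * ∫ ω, F (openCluster ω x) ∂(prodBernoulli w)) := by
  classical
  set μ := prodBernoulli w with hμ
  set D : Set (BondConfig V) := {ω | ¬ (openGraph ω).Reachable x y} with hD
  set f : BondConfig V → ℝ := fun ω => F (openCluster ω x) with hf
  set J : Set (BondConfig V) := openConn x o ∪ openConn y o with hJ
  have hmain := obs_mixture_ge w o x y hxy F hF
  change μ.real D * μ.real J * ∫ ω, f ω ∂μ ≤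
    μ.real D * ∫ ω in openConn x o, f ω ∂μ + μ.real (D ∩ openConn y o) * ∫ ω in D, f ω ∂μ at hmain
  show μ.real (D ∩ openConn y o) * (∫ ω in openConn x y, f ω ∂μ - μ.real (openConn x y) * ∫ ω, f ω ∂μ) ≤
    μ.real D * (∫ ω in openConn x o, f ω ∂μ - μ.real (openConn x o) * ∫ ω, f ω ∂μ)
  -- `D = (x ↔ y)ᶜ`
  have hDc : D = (openConn x y)ᶜ := rfl
  have hmD : MeasurableSet (openConn x y : Set (BondConfig V)) := MeasurableSet.of_discrete
  -- `μ(J) = μ(x↔o) + μ(D ∩ {y↔o})`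
  have hJeq : J = openConn x o ∪ (D ∩ openConn y o) := by
    ext ω
    simp only [hJ, hD, mem_union, mem_inter_iff, mem_setOf_eq, openConn]
    constructor
    · rintro (h | h)
      · exact Or.inl h
      · by_cases hxo : (openGraph ω).Reachable x o
        · exact Or.inl hxo
        · refine Or.inr ⟨fun hxy' => hxo (hxy'.trans h), h⟩
    · rintro (h | ⟨_, h⟩)
      · exact Or.inl h
      · exact Or.inr h
  have hdisj : Disjoint (openConn x o) (D ∩ openConn y o) := by
    rw [Set.disjoint_left]
    rintro ω hxo ⟨hD', hyo⟩
    exact hD' (SimpleGraph.Reachable.trans hxo (SimpleGraph.Reachable.symm hyo))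
  have hJm : μ.real J = μ.real (openConn x o) + μ.real (D ∩ openConn y o) := by
    rw [hJeq, measureReal_union hdisj MeasurableSet.of_discrete]
  -- `∫_D f = ∫ f - ∫_{x↔y} f` and `μ(D) = 1 - μ(x↔y)`
  have hIf : ∫ ω in D, f ω ∂μ = ∫ ω, f ω ∂μ - ∫ ω in openConn x y, f ω ∂μ := by
    have e := integral_add_compl hmD (Integrable.of_finite : Integrable f μ)
    rw [hDc]
    linarith
  have hmDc : μ.real D = 1 - μ.real (openConn x y) := by
    rw [hDc, measureReal_compl hmD, probReal_univ]
  rw [hJm, hIf] at hmain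
  rw [hmDc] at hmain ⊢
  nlinarith [hmain]

end Q7Psi

end

end Summit.CriticalPhenomena.PercolationContinuityZ3.Theorems
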